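import Summits.Schanuel.Schanuel.Theorems.ZilberEacFibreCurveCylinderAll
import Summits.Schanuel.Schanuel.Theorems.ZilberEacFermatCase
import HarnessLib

/-!
# Arbitrary base branches, XCVIII: `y₀`-CYLINDERS BY THE INDEX SWAP — every surface of
# Mantova–Masser's case over a curve defined over `ℚ̄` whose equations omit ONE of the two
# multiplicative coordinates is dense

HONEST FRAMING.  Cell `pub-schanuel` (Zilber's Exponential-Algebraic Closedness, case ladder;
host summit Schanuel), seat 2, gen 33.  File XCVII settled the `y₁`-cylinders (surfaces fibred in
`y₀`-curves) over curves defined over `ℚ̄`.  The index swap `(x₀, y₀) ↔ (x₁, y₁)` of the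
Literature (`indexSwapped`, `mmCaseDimPiOneFree_indexSwapped`, `unprojectedDense_indexSwapped`)
turns a `y₀`-cylinder over `C : F = 0` into a `y₁`-cylinder over the transposed curve
`Cᵗ : F(x₁, x₀) = 0`; the only new ingredient is the transport of the base closure
`cl π(W ∩ G²)` under the swap (**`mem_zeroLocus_vanishingIdeal_projAdd_indexSwapped`**).
Results: **`unprojectedDense_of_mmCase_cylinder₀`** (`y₀`-cylinders) and
**`unprojectedDense_of_mmCase_cylinder_either`**: for `F ∈ ℚ̄[x₀][x₁]` irreducible with
irreducible transpose, EVERY surface of the case over `{F = 0}` invariant under `y₁ ↦ t` OR under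
`y₀ ↦ t` has Zariski-dense exponential points.  What remains OPEN over such curves: surfaces whose
equations involve both `y₀` and `y₁` genuinely (Mantova–Masser's exponential-polynomial regime);
transcendental coefficients; Fib(3,2); EC(3,2); the question in general; NOT Schanuel's conjecture
(neither used nor implied); EAC ⇏ SC.
-/

noncomputable section

open Filter Topology Set Complex Polynomial
open Literature.NumberTheory.Transcendental Literature.ModelTheory.Zilber
open Literature.ModelTheory.ExponentialFields

set_option linter.dupNamespace false

namespace Summit.Schanuel.Schanuel.Theorems

section FibreCurveCylinderSwap

/-! ## Part A. The base closure under the index swap -/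

/-- The Zariski closure of a coordinate-swapped plane set is the swap of the closure. [folklore] -/
theorem mem_zeroLocus_vanishingIdeal_image_swap (A : Set (Fin 2 → ℂ)) (x : Fin 2 → ℂ) :
    x ∈ MvPolynomial.zeroLocus ℂ (MvPolynomial.vanishingIdeal ℂ
        ((fun a : Fin 2 → ℂ => a ∘ Equiv.swap (0 : Fin 2) 1) '' A)) ↔
      x ∘ Equiv.swap (0 : Fin 2) 1 ∈ MvPolynomial.zeroLocus ℂ (MvPolynomial.vanishingIdeal ℂ A) := by
  have hss : ∀ a : Fin 2 → ℂ, (a ∘ Equiv.swap (0 : Fin 2) 1) ∘ Equiv.swap (0 : Fin 2) 1 = a := by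
    intro a; funext i; simp [Equiv.swap_apply_self]
  rw [MvPolynomial.mem_zeroLocus_iff, MvPolynomial.mem_zeroLocus_iff]
  constructor
  · intro hx q hq
    have hp : MvPolynomial.rename (Equiv.swap (0 : Fin 2) 1) q ∈ MvPolynomial.vanishingIdeal ℂ
        ((fun a : Fin 2 → ℂ => a ∘ Equiv.swap (0 : Fin 2) 1) '' A) := by
      rw [MvPolynomial.mem_vanishingIdeal_iff]
      rintro _ ⟨a, ha, rfl⟩
      rw [MvPolynomial.aeval_eq_eval, MvPolynomial.eval_rename, hss]
      have h := (MvPolynomial.mem_vanishingIdeal_iff.1 hq) a ha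
      rwa [MvPolynomial.aeval_eq_eval] at h
    have h := hx _ hp
    rwa [MvPolynomial.aeval_eq_eval, MvPolynomial.eval_rename, ← MvPolynomial.aeval_eq_eval] at h
  · intro hx p hp
    have hq : MvPolynomial.rename (Equiv.swap (0 : Fin 2) 1) p ∈ MvPolynomial.vanishingIdeal ℂ A := by
      rw [MvPolynomial.mem_vanishingIdeal_iff]
      intro a ha
      rw [MvPolynomial.aeval_eq_eval, MvPolynomial.eval_rename]
      have h := (MvPolynomial.mem_vanishingIdeal_iff.1 hp) _ ⟨a, ha, rfl⟩
      rwa [MvPolynomial.aeval_eq_eval] at h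
    have h := hx _ hq
    rwa [MvPolynomial.aeval_eq_eval, MvPolynomial.eval_rename, hss, ← MvPolynomial.aeval_eq_eval] at h

/-- The additive projection of the swapped surface's torus part is the swap of the original one.
[folklore] -/
theorem projAdd_image_indexSwapped_inter_torusLocus (W : Set (Fin 2 ⊕ Fin 2 → ℂ)) :
    projAdd '' (indexSwapped W ∩ torusLocus ℂ 2) =
      (fun a : Fin 2 → ℂ => a ∘ Equiv.swap (0 : Fin 2) 1) '' (projAdd '' (W ∩ torusLocus ℂ 2)) := by
  have hproj : ∀ z : Fin 2 ⊕ Fin 2 → ℂ,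
      projAdd z = (projAdd (z ∘ idxSwap)) ∘ Equiv.swap (0 : Fin 2) 1 := by
    intro z; funext i
    fin_cases i <;> simp [projAdd, idxSwap_inl]
  ext x
  constructor
  · rintro ⟨z, ⟨hzW, hzT⟩, rfl⟩
    refine ⟨projAdd (z ∘ idxSwap), ⟨z ∘ idxSwap, ⟨hzW, ?_⟩, rfl⟩, (hproj z).symm⟩
    have : z ∈ indexSwapped (torusLocus ℂ 2) := by rw [indexSwapped_torusLocus]; exact hzT
    exact this
  · rintro ⟨_, ⟨z, ⟨hzW, hzT⟩, rfl⟩, rfl⟩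
    refine ⟨z ∘ idxSwap, ⟨?_, ?_⟩, ?_⟩
    · show (z ∘ idxSwap) ∘ idxSwap ∈ W
      rw [comp_idxSwap_comp_idxSwap]; exact hzW
    · have : z ∘ idxSwap ∈ indexSwapped (torusLocus ℂ 2) := by
        show (z ∘ idxSwap) ∘ idxSwap ∈ torusLocus ℂ 2
        rw [comp_idxSwap_comp_idxSwap]; exact hzT
      rwa [indexSwapped_torusLocus] at this
    · rw [hproj (z ∘ idxSwap), comp_idxSwap_comp_idxSwap]

/-- **The base closure of the swapped surface.** [folklore] -/
theorem mem_zeroLocus_vanishingIdeal_projAdd_indexSwapped (W : Set (Fin 2 ⊕ Fin 2 → ℂ))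
    (x : Fin 2 → ℂ) :
    x ∈ MvPolynomial.zeroLocus ℂ (MvPolynomial.vanishingIdeal ℂ
        (projAdd '' (indexSwapped W ∩ torusLocus ℂ 2))) ↔
      x ∘ Equiv.swap (0 : Fin 2) 1 ∈ MvPolynomial.zeroLocus ℂ (MvPolynomial.vanishingIdeal ℂ
        (projAdd '' (W ∩ torusLocus ℂ 2))) := by
  rw [projAdd_image_indexSwapped_inter_torusLocus, mem_zeroLocus_vanishingIdeal_image_swap]

/-! ## Part B. `y₀`-cylinders -/

variable (F : ℂ[X][X])

/-- **`y₀`-CYLINDERS OF THE CASE OVER A CURVE DEFINED OVER `ℚ̄` ARE DENSE.**  `F` irreducible,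
`Ft` its transpose (`Ft(x, y) = F(y, x)`) irreducible with algebraic coefficients; `W` in
Mantova–Masser's case with base curve `{F = 0}`, invariant under `y₀ ↦ t`: Zariski-dense
exponential points. [cite: MantovaMasser2023, §1 Further remarks, p. 5 (the question, open in
general)] (new) -/
theorem unprojectedDense_of_mmCase_cylinder₀ (Ft : ℂ[X][X])
    (hFt : ∀ x y : ℂ, (Ft.map (Polynomial.evalRingHom x)).eval y =
      (F.map (Polynomial.evalRingHom y)).eval x)
    (hFtirr : Irreducible Ft) (halgt : ∀ i j, IsAlgebraic ℚ ((Ft.coeff j).coeff i))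
    {W : Set (Fin 2 ⊕ Fin 2 → ℂ)} (hmm : MMCaseDimPiOneFree W)
    (hbase : MvPolynomial.zeroLocus ℂ (MvPolynomial.vanishingIdeal ℂ (projAdd '' (W ∩ torusLocus ℂ 2))) =
      {x : Fin 2 → ℂ | (F.map (Polynomial.evalRingHom (x 0))).eval (x 1) = 0})
    (hcyl₀ : ∀ w ∈ W, ∀ t : ℂ, Function.update w (Sum.inr 0) t ∈ W) :
    UnprojectedDense W := by
  classical
  have hmm' : MMCaseDimPiOneFree (indexSwapped W) := mmCaseDimPiOneFree_indexSwapped hmm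
  have hbase' : MvPolynomial.zeroLocus ℂ (MvPolynomial.vanishingIdeal ℂ
      (projAdd '' (indexSwapped W ∩ torusLocus ℂ 2))) =
      {x : Fin 2 → ℂ | (Ft.map (Polynomial.evalRingHom (x 0))).eval (x 1) = 0} := by
    ext x
    rw [mem_zeroLocus_vanishingIdeal_projAdd_indexSwapped, hbase]
    simp only [Set.mem_setOf_eq, Function.comp_apply, Equiv.swap_apply_left,
      Equiv.swap_apply_right, hFt]
  have hcyl' : ∀ z ∈ indexSwapped W, ∀ t : ℂ, Function.update z (Sum.inr 1) t ∈ indexSwapped W := by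
    intro z hz t
    rw [mem_indexSwapped_iff] at hz ⊢
    have e : Function.update z (Sum.inr 1) t ∘ idxSwap = Function.update (z ∘ idxSwap) (Sum.inr 0) t := by
      funext k
      rcases k with i | i <;> fin_cases i <;>
        simp [idxSwap_inl, idxSwap_inr]
    rw [e]
    exact hcyl₀ _ hz t
  have h := unprojectedDense_of_mmCase_cylinder Ft hFtirr halgt hmm' hbase' hcyl'
  rw [← indexSwapped_indexSwapped W]
  exact unprojectedDense_indexSwapped h

/-- **EVERY SURFACE OF THE CASE OVER A CURVE OVER `ℚ̄` WHOSE EQUATIONS OMIT ONE MULTIPLICATIVE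
COORDINATE IS DENSE** (`y₁`-cylinders: file XCVII; `y₀`-cylinders: the swap).
[cite: MantovaMasser2023, §1 Further remarks, p. 5 (the question, open in general)] (new) -/
theorem unprojectedDense_of_mmCase_cylinder_either (hFirr : Irreducible F)
    (halg : ∀ i j, IsAlgebraic ℚ ((F.coeff j).coeff i)) (Ft : ℂ[X][X])
    (hFt : ∀ x y : ℂ, (Ft.map (Polynomial.evalRingHom x)).eval y =
      (F.map (Polynomial.evalRingHom y)).eval x)
    (hFtirr : Irreducible Ft) (halgt : ∀ i j, IsAlgebraic ℚ ((Ft.coeff j).coeff i))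
    {W : Set (Fin 2 ⊕ Fin 2 → ℂ)} (hmm : MMCaseDimPiOneFree W)
    (hbase : MvPolynomial.zeroLocus ℂ (MvPolynomial.vanishingIdeal ℂ (projAdd '' (W ∩ torusLocus ℂ 2))) =
      {x : Fin 2 → ℂ | (F.map (Polynomial.evalRingHom (x 0))).eval (x 1) = 0})
    (hcyl : (∀ w ∈ W, ∀ t : ℂ, Function.update w (Sum.inr 1) t ∈ W) ∨
      (∀ w ∈ W, ∀ t : ℂ, Function.update w (Sum.inr 0) t ∈ W)) :
    UnprojectedDense W := by
  rcases hcyl with h | h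
  · exact unprojectedDense_of_mmCase_cylinder F hFirr halg hmm hbase h
  · exact unprojectedDense_of_mmCase_cylinder₀ F Ft hFt hFtirr halgt hmm hbase h

/-- **Example: the Fermat cubic `x₀³ + x₁³ = 1` is its own transpose** — every surface of the
case over it whose equations omit `y₀` or `y₁` is dense. [cite: MantovaMasser2023, §1 Further
remarks, p. 5 (the question, open in general)] (new) -/
theorem unprojectedDense_of_mmCase_fermatCubic_cylinder_either {W : Set (Fin 2 ⊕ Fin 2 → ℂ)}
    (hmm : MMCaseDimPiOneFree W)
    (hbase : MvPolynomial.zeroLocus ℂ (MvPolynomial.vanishingIdeal ℂ (projAdd '' (W ∩ torusLocus ℂ 2))) =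
      {x : Fin 2 → ℂ | x 0 ^ 3 + x 1 ^ 3 - 1 = 0})
    (hcyl : (∀ w ∈ W, ∀ t : ℂ, Function.update w (Sum.inr 1) t ∈ W) ∨
      (∀ w ∈ W, ∀ t : ℂ, Function.update w (Sum.inr 0) t ∈ W)) :
    UnprojectedDense W := by
  classical
  -- `F = X³ + C(X³ - 1)`: its own transpose
  set F : ℂ[X][X] := Polynomial.X ^ 3 + Polynomial.C (Polynomial.X ^ 3 - 1 : ℂ[X]) with hF
  have hev : ∀ x y : ℂ, (F.map (Polynomial.evalRingHom x)).eval y = x ^ 3 + y ^ 3 - 1 := by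
    intro x y
    simp only [hF, Polynomial.map_add, Polynomial.map_pow, Polynomial.map_X, Polynomial.map_C,
      Polynomial.coe_evalRingHom, Polynomial.eval_add, Polynomial.eval_pow, Polynomial.eval_X,
      Polynomial.eval_C, Polynomial.eval_sub, Polynomial.eval_one]
    ring
  have hFt : ∀ x y : ℂ, (F.map (Polynomial.evalRingHom x)).eval y =
      (F.map (Polynomial.evalRingHom y)).eval x := by
    intro x y; rw [hev, hev]; ring
  have hPQ : ∀ x y : ℂ, MvPolynomial.eval ![x, y] ((MvPolynomial.X 0 : MvPolynomial (Fin 2) ℂ) ^ 3 +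
      MvPolynomial.X 1 ^ 3 - 1) = (F.map (Polynomial.evalRingHom x)).eval y := by
    intro x y
    rw [hev]
    simp
  have hirr : Irreducible F := (irreducible_rows_iff hPQ).1 (irreducible_fermatCurvePoly (by norm_num))
  have halg : ∀ i j, IsAlgebraic ℚ ((F.coeff j).coeff i) := by
    intro i j
    have hmap : F = (Polynomial.X ^ 3 + Polynomial.C (Polynomial.X ^ 3 - 1 : ℚ[X]) : ℚ[X][X]).map
        (Polynomial.mapRingHom (algebraMap ℚ ℂ)) := by
      rw [hF]
      simp only [Polynomial.map_add, Polynomial.map_pow, Polynomial.map_X, Polynomial.map_C,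
        Polynomial.coe_mapRingHom, Polynomial.map_sub, Polynomial.map_one]
    rw [hmap, Polynomial.coeff_map, Polynomial.coe_mapRingHom, Polynomial.coeff_map]
    exact isAlgebraic_algebraMap _
  have hbase' : MvPolynomial.zeroLocus ℂ (MvPolynomial.vanishingIdeal ℂ
      (projAdd '' (W ∩ torusLocus ℂ 2))) =
      {x : Fin 2 → ℂ | (F.map (Polynomial.evalRingHom (x 0))).eval (x 1) = 0} := by
    rw [hbase]; ext x; simp only [Set.mem_setOf_eq, hev]
  exact unprojectedDense_of_mmCase_cylinder_either F hirr halg F hFt hirr halg hmm hbase' hcyl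

end FibreCurveCylinderSwap

end Summit.Schanuel.Schanuel.Theorems
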